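import Summits.NavierStokesRegularity.NavierStokesRegularity.Theorems.SelfMixingDichotomyCoherentScaleExclusionKinWitnessTypeICoherence
import Summits.NavierStokesRegularity.NavierStokesRegularity.Theorems.SelfMixingDichotomyCoherentScaleExclusionKinWitnessLoadLowerBound
import Summits.NavierStokesRegularity.NavierStokesRegularity.Theorems.SelfMixingDichotomyCoherentScaleExclusionKinWitnessDivFree
import Summits.NavierStokesRegularity.NavierStokesRegularity.Theorems.SelfMixingDichotomyCoherentScaleExclusionKinWitnessSmooth
import Summits.NavierStokesRegularity.NavierStokesRegularity.Theorems.SelfMixingDichotomyCoherentScaleExclusionKinWitnessWindowBounds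
import Summits.NavierStokesRegularity.NavierStokesRegularity.Theorems.SelfMixingDichotomyCoherentScaleExclusionKinWitnessLoadPiece
import Summits.NavierStokesRegularity.NavierStokesRegularity.Theorems.SelfMixingDichotomyCoherentScaleExclusionKinWitnessPointwise
import Literature.Analysis.FluidPDE.DissipatesAtScale
import Literature.Analysis.FluidPDE.SuitableWeak
import HarnessLib

set_option linter.dupNamespace false

/-!
# Route SelfMixingDichotomy — crux `CoherentScaleExclusion` (S2, stmt-NavierStokesRegularity-1423):
# the cascade stub is NOT a kinematic fact — an explicit coherent Type-I swirling core

`--supports stmt-NavierStokesRegularity-1423`, line lead c2 of `Cruxes/CoherentScaleExclusion/Lines/birth.lean`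
(assembly of the registered sub-goals `kinWitness_*`, all landed).

The registered stub B `stub_coherentCascadeExclusion` of the birth line says: for `0 < δ < 1`, no finite-energy
classical Navier–Stokes solution has a final-time point at which the scaled cubic load diverges along all small
scales (`C(r) = cknC r (T,x₀) u → ∞`) while non-`δ`-mixing scales recur (`¬ DissipatesAtScale u T x₀ r δ` for
arbitrarily small `r`). THIS FILE shows that the two hypotheses of B are jointly satisfiable by a smooth,
divergence-free, finite-energy drift obeying even an `L∞` Type-I bound — so B (and with it the crux S2, which
implies B: `cascadeRegime_of_coherentScaleExclusion`) cannot be proved from kinematics (incompressibility, energy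
class, Type-I rate, smoothness before `T`): any proof must use the momentum equation.

THE WITNESS (blow-up time `T = 1`, centre `x₀ = 0`). With `J x = (−x₁, x₀, 0)` (rotation about the `x₂`-axis),
core radius `ρ(t) = (1−t)^{3/8}` and the smooth cutoff `expNegInvGlue`:

  `uW t x = (1−t)^{−7/8} · expNegInvGlue (4 − ‖x‖² / (1−t)^{3/4}) • J x`  for `t < 1`,  `uW t x = 0` for `t ≥ 1`.

A solid-body-like swirling eddy of radius `2ρ(t) → 0` and speed `≤ 2 (1−t)^{−1/2}` (Type-I(2)), energy
`≤ 32 |B₁| (1−t)^{1/8}`, whose load at the tip satisfies `C(r) ≥ κ r^{−1/3} → ∞` (the core is much wider than the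
parabolic scale: `ρ(t)/√(1−t) = (1−t)^{−1/8} → ∞`), and which is non-`δ`-mixing at EVERY small scale for
`δ ≤ δ₁(2)` because under an `L∞` Type-I drift bound the scalar floor of the `MixingPayoff` line is drift-generic
(`kinWitness_typeICoherence_of_windowBounds`): a bump datum keeps a fixed fraction of its `L²` mass. Radial data
about the axis are not stirred at all by `uW` (`uW · ∇θ = 0`), which is the CKRZ picture of a non-relaxation-
enhancing flow; the floor argument does not even need that.

## Contents
* `kinWitness_contDiffOn_oneSub_rpow` — `t ↦ (1−t)^c` is smooth before `t = 1`;
* `coherentCascade_kinematicWitness` — the witness packaged as one existential statement (smooth space–time field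
  on `[0,1) × ℝ³`, divergence free, uniformly bounded energy, Type-I(2), `C(r) → ∞` at `(1,0)`, `¬ MIX(r,δ)` for
  all `r < r₂` and hence recurrently); the field `uW` is written out once inside the proof (no definition);
* `stub_coherentCascadeExclusion_false_without_momentum` (registered sub-goal) — the statement of stub B with the
  Navier–Stokes class (`IsClassicalNSSolutionOn ∧ IsLerayHopfOn ∧ HasRapidSpatialDecay (u 0)`) replaced by the
  kinematic class (smooth on `[0,T) × ℝ³`, divergence free, uniformly bounded energy, `L∞` Type-I(2)) is FALSE.
-/

noncomputable section

open Literature.Analysis.FluidPDE MeasureTheory Set Function Metric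
open scoped ContDiff

namespace Summit.NavierStokesRegularity.NavierStokesRegularity.Theorems

/-- `t ↦ (1 − t)^c` is smooth on `(−∞, 1)` (real power of a positive base). -/
theorem kinWitness_contDiffOn_oneSub_rpow (c : ℝ) :
    ContDiffOn ℝ ∞ (fun t : ℝ => (1 - t) ^ c) (Set.Iio 1) := by
  intro t ht
  have hne : (1 - t : ℝ) ≠ 0 := by
    have : t < 1 := ht
    linarith
  have h1 : ContDiffAt ℝ ∞ (fun s : ℝ => (1 - s)) t := contDiffAt_const.sub contDiffAt_id
  exact ((Real.contDiffAt_rpow_const_of_ne (p := c) hne).comp t h1).contDiffWithinAt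

/-- **Kinematic witness against the cascade stub.** There are `δ ∈ (0,1)` and a drift `u : ℝ → ℝ³ → ℝ³` that
is a smooth space–time field on `[0,1) × ℝ³`, divergence free at every time, of uniformly bounded finite energy
from time `0` on, obeying the `L∞` Type-I bound `√(1−t)‖u‖ ≤ 2` before `t = 1`, whose scaled cubic load at
`(1,0)` diverges along ALL small scales (`∀ M', ofReal M' ≤ cknC r (1,0) u` for all small `r`: the pure-cascade
hypothesis of stub B) and which is non-`δ`-mixing at EVERY small scale (`¬ DissipatesAtScale u 1 0 r δ` for all
`r < r₂`, in particular recurrently: the coherence hypothesis of stub B). The witness is the swirling core `uW` of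
the module docstring; the proof assembles the registered sub-goals `kinWitness_contDiffOn_swirlField` (joint
smoothness), `kinWitness_pointwise` (support, Type-I bound, energy), `kinWitness_windowBounds_of_spatialSupport`
(bounded derivatives on windows), `kinWitness_typeICoherence_of_windowBounds` (drift-generic Type-I floor ⇒
`¬ MIX`), `kinWitness_isDivFree_swirlField`, `kinWitness_loadPiece` + `kinWitness_cknC_lowerBound_of_le_norm`
(`C(r) ≥ κ r^{−1/3} |B₁|`). -/
theorem coherentCascade_kinematicWitness : ∃ δ : ℝ, 0 < δ ∧ δ < 1 ∧
    ∃ u : ℝ → EuclideanSpace ℝ (Fin 3) → EuclideanSpace ℝ (Fin 3),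
      IsSmoothSpaceTimeOn (Set.Ico 0 1) u ∧
      (∀ t : ℝ, VectorCalculus.IsDivFree (u t)) ∧
      (∃ E₀ : ℝ, ∀ t : ℝ, 0 ≤ t → MemLp (u t) 2 volume ∧ ∫ x, ‖u t x‖ ^ 2 ≤ E₀) ∧
      (∀ t : ℝ, t < 1 → ∀ x : EuclideanSpace ℝ (Fin 3), Real.sqrt (1 - t) * ‖u t x‖ ≤ 2) ∧
      (∀ M' : ℝ, ∃ r₁ : ℝ, 0 < r₁ ∧ ∀ r ∈ Set.Ioo 0 r₁,
        ENNReal.ofReal M' ≤ cknC r (((1 : ℝ), (0 : EuclideanSpace ℝ (Fin 3))) : ℝ × EuclideanSpace ℝ (Fin 3)) u) ∧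
      (∃ r₂ : ℝ, 0 < r₂ ∧ ∀ r ∈ Set.Ioo 0 r₂, ¬ DissipatesAtScale u 1 0 r δ) ∧
      (∀ r₀ : ℝ, 0 < r₀ → ∃ r ∈ Set.Ioo 0 r₀, ¬ DissipatesAtScale u 1 0 r δ) := by
  -- the landed pointwise facts and the load piece, stated for the explicit field
  obtain ⟨hsupp, hTI, hE⟩ := kinWitness_pointwise
  obtain ⟨κ, hκ, hpiece⟩ := kinWitness_loadPiece
  -- the witness field, named locally
  set F : ℝ → EuclideanSpace ℝ (Fin 3) → EuclideanSpace ℝ (Fin 3) :=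
    (fun (t : ℝ) (x : EuclideanSpace ℝ (Fin 3)) => if t < 1 then
      ((1 - t) ^ (-(7/8 : ℝ)) * expNegInvGlue (4 - ‖x‖ ^ 2 / (1 - t) ^ (3/4 : ℝ))) •
        (WithLp.toLp 2 ![-(x 1), x 0, 0] : EuclideanSpace ℝ (Fin 3)) else 0) with hF
  -- (1) joint smoothness on `(−∞, 1) × ℝ³`
  have hcd : ContDiffOn ℝ ∞ (Function.uncurry F) (Set.Iio 1 ×ˢ Set.univ) := by
    have hφ : ContDiff ℝ ((⊤ : ℕ∞) : WithTop ℕ∞) (fun s : ℝ => expNegInvGlue (4 - s)) :=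
      expNegInvGlue.contDiff.comp (contDiff_const.sub contDiff_id)
    have hg := kinWitness_contDiffOn_oneSub_rpow (-(7/8 : ℝ))
    have hh := kinWitness_contDiffOn_oneSub_rpow (3/4 : ℝ)
    have hh0 : ∀ t ∈ Set.Iio (1 : ℝ), (1 - t) ^ (3/4 : ℝ) ≠ 0 := by
      intro t ht
      have : t < 1 := ht
      exact (Real.rpow_pos_of_pos (by linarith) _).ne'
    have h := kinWitness_contDiffOn_swirlField (fun s : ℝ => expNegInvGlue (4 - s)) hφ
      (fun t : ℝ => (1 - t) ^ (-(7/8 : ℝ))) (fun t : ℝ => (1 - t) ^ (3/4 : ℝ)) (Set.Iio 1) isOpen_Iio hg hh hh0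
    refine h.congr ?_
    rintro ⟨t, x⟩ hp
    have ht : t < 1 := (Set.mem_prod.1 hp).1
    simp only [hF, Function.uncurry_apply_pair, if_pos ht]
  -- (2) spatial support: on `(−1/2, 1) × ℝ³` the field vanishes where `‖x‖ ≥ 3`
  have hvan : ∀ p ∈ Set.Ioo (-(1/2 : ℝ)) 1 ×ˢ (Set.univ : Set (EuclideanSpace ℝ (Fin 3))),
      (3 : ℝ) ≤ ‖p.2‖ → Function.uncurry F p = 0 := by
    rintro ⟨t, x⟩ hp h3
    obtain ⟨ht1, ht2⟩ : -(1/2 : ℝ) < t ∧ t < 1 := (Set.mem_prod.1 hp).1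
    have hs : 0 < 1 - t := by linarith
    -- the core radius `2 (1 - t)^{3/8}` is below `3`
    have hρ : (1 - t) ^ (3/8 : ℝ) ≤ 3 / 2 := by
      rcases le_or_gt (1 - t) 1 with h | h
      · exact (Real.rpow_le_one hs.le h (by norm_num)).trans (by norm_num)
      · calc (1 - t) ^ (3/8 : ℝ) ≤ (1 - t) ^ (1 : ℝ) :=
              Real.rpow_le_rpow_of_exponent_le h.le (by norm_num)
          _ = 1 - t := Real.rpow_one _
          _ ≤ 3 / 2 := by linarith
    have hx : 2 * (1 - t) ^ (3/8 : ℝ) ≤ ‖x‖ := by linarith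
    exact hsupp t x ht2 hx
  -- (3) window regularity: smooth with all derivatives bounded on every `[a,b] ⊂ [0,1)`
  have hwin : ∀ a b : ℝ, 0 ≤ a → a < b → b < 1 →
      IsSmoothSpaceTimeOn (Set.Icc a b) F ∧ ∀ n : ℕ, ∃ C : ℝ, ∀ t ∈ Set.Icc a b,
        ∀ x : EuclideanSpace ℝ (Fin 3),
        ‖iteratedFDerivWithin ℝ n (Function.uncurry F) (Set.Icc a b ×ˢ Set.univ) (t, x)‖ ≤ C := by
    intro a b ha hab hb
    have hU : IsOpen (Set.Ioo (-(1/2 : ℝ)) 1 ×ˢ (Set.univ : Set (EuclideanSpace ℝ (Fin 3)))) :=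
      isOpen_Ioo.prod isOpen_univ
    have hsub : Set.Icc a b ×ˢ (Set.univ : Set (EuclideanSpace ℝ (Fin 3))) ⊆
        Set.Ioo (-(1/2 : ℝ)) 1 ×ˢ Set.univ :=
      Set.prod_mono (fun t ht => ⟨by linarith [ht.1], lt_of_le_of_lt ht.2 hb⟩) Subset.rfl
    have hcd' : ContDiffOn ℝ ((⊤ : ℕ∞) : WithTop ℕ∞) (Function.uncurry F)
        (Set.Ioo (-(1/2 : ℝ)) 1 ×ˢ (Set.univ : Set (EuclideanSpace ℝ (Fin 3)))) :=
      hcd.mono (Set.prod_mono (fun t ht => ht.2) Subset.rfl)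
    exact kinWitness_windowBounds_of_spatialSupport F _ a b 3 hab hU hsub hcd' hvan
  -- (4) coherence at every small scale: the drift-generic Type-I floor with `K = 2`
  obtain ⟨δ₁, hδ₁, hcoh⟩ := kinWitness_typeICoherence_of_windowBounds 2 two_pos
  have hTI' : ∃ r₁ : ℝ, 0 < r₁ ∧ ∀ t ∈ Set.Ioo (1 - r₁ ^ 2) 1,
      ∀ x ∈ Metric.ball (0 : EuclideanSpace ℝ (Fin 3)) r₁, Real.sqrt (1 - t) * ‖F t x‖ ≤ 2 :=
    ⟨1, one_pos, fun t ht x _ => hTI t x ht.2⟩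
  obtain ⟨r₂, hr₂, hmix⟩ := hcoh 1 one_pos F hwin 0 hTI'
  -- (5) divergence of the load at the tip `(1, 0)`
  have hcasc : ∀ M' : ℝ, ∃ r₁ : ℝ, 0 < r₁ ∧ ∀ r ∈ Set.Ioo 0 r₁, ENNReal.ofReal M' ≤
      cknC r (((1 : ℝ), (0 : EuclideanSpace ℝ (Fin 3))) : ℝ × EuclideanSpace ℝ (Fin 3)) F := by
    intro M'
    -- the unit-ball volume `V ∈ (0, ∞)`
    set v : ENNReal := volume (Metric.ball (0 : EuclideanSpace ℝ (Fin 3)) 1) with hv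
    have hv0 : v ≠ 0 := (Metric.measure_ball_pos volume (0 : EuclideanSpace ℝ (Fin 3)) one_pos).ne'
    have hvtop : v ≠ ⊤ := measure_ball_lt_top.ne
    set V : ℝ := v.toReal with hV
    have hVpos : 0 < V := ENNReal.toReal_pos hv0 hvtop
    -- threshold `L = max M' 0 + 1`, radius `r₁ = min 1 ((κ V / L)^3)`
    set L : ℝ := max M' 0 + 1 with hL
    have hLpos : 0 < L := by positivity
    have hq : 0 < κ * V / L := by positivity
    refine ⟨min 1 ((κ * V / L) ^ 3), lt_min one_pos (by positivity), ?_⟩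
    intro r hr
    obtain ⟨hr0, hr1⟩ := hr
    have hr_lt1 : r < 1 := hr1.trans_le (min_le_left _ _)
    have hr_lt : r < (κ * V / L) ^ 3 := hr1.trans_le (min_le_right _ _)
    obtain ⟨a, b, s, m, c, ha, hab, hb, hs, hm, hball, hlow, hgrow⟩ := hpiece r hr0 hr_lt1
    have hC := kinWitness_cknC_lowerBound_of_le_norm F 1 0 r hr0 a b s m c ha hab hb hs hm hball hlow
    refine le_trans ?_ hC
    have hgrow' : κ * r ^ (-(1/3 : ℝ)) * V ≤ (b - a) * s ^ 3 * m ^ 3 / r ^ 2 * V :=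
      mul_le_mul_of_nonneg_right hgrow hVpos.le
    -- `L ≤ κ V r^{-1/3}` from `r < (κV/L)^3`
    have hr13 : r ^ ((1 : ℝ) / 3) < κ * V / L := by
      have h1 : r ^ ((1 : ℝ) / 3) < ((κ * V / L) ^ 3) ^ ((1 : ℝ) / 3) :=
        Real.rpow_lt_rpow hr0.le hr_lt (by norm_num)
      have h2 : ((κ * V / L) ^ 3) ^ ((1 : ℝ) / 3) = κ * V / L := by
        rw [← Real.rpow_natCast, ← Real.rpow_mul hq.le]
        norm_num
      rwa [h2] at h1
    have hrpow_pos : 0 < r ^ ((1 : ℝ) / 3) := Real.rpow_pos_of_pos hr0 _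
    have hneg : r ^ (-(1/3 : ℝ)) = (r ^ ((1 : ℝ) / 3))⁻¹ := by
      rw [show (-(1/3 : ℝ)) = -((1 : ℝ) / 3) by norm_num, Real.rpow_neg hr0.le]
    have hLle : L ≤ κ * r ^ (-(1/3 : ℝ)) * V := by
      rw [hneg]
      have h3 : L * r ^ ((1 : ℝ) / 3) ≤ κ * V := by
        have := (lt_div_iff₀ hLpos).1 hr13
        nlinarith
      calc L = L * r ^ ((1 : ℝ) / 3) * (r ^ ((1 : ℝ) / 3))⁻¹ := by
            field_simp
        _ ≤ κ * V * (r ^ ((1 : ℝ) / 3))⁻¹ :=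
            mul_le_mul_of_nonneg_right h3 (inv_nonneg.2 hrpow_pos.le)
        _ = κ * (r ^ ((1 : ℝ) / 3))⁻¹ * V := by ring
    have hM'L : M' ≤ L := by
      have := le_max_left M' 0
      linarith
    have hkey : M' ≤ (b - a) * s ^ 3 * m ^ 3 / r ^ 2 * V := hM'L.trans (hLle.trans hgrow')
    have hnonneg : 0 ≤ (b - a) * s ^ 3 * m ^ 3 / r ^ 2 := by
      have : 0 < b - a := by linarith
      positivity
    calc ENNReal.ofReal M' ≤ ENNReal.ofReal ((b - a) * s ^ 3 * m ^ 3 / r ^ 2 * V) :=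
          ENNReal.ofReal_le_ofReal hkey
      _ = ENNReal.ofReal ((b - a) * s ^ 3 * m ^ 3 / r ^ 2) * v := by
          rw [ENNReal.ofReal_mul hnonneg, hV, ENNReal.ofReal_toReal hvtop]
  -- (6) every slice is divergence free
  have hdiv : ∀ t : ℝ, VectorCalculus.IsDivFree (F t) := by
    intro t
    by_cases ht : t < 1
    · have hφ : ContDiff ℝ 1 (fun s : ℝ => expNegInvGlue (4 - s / (1 - t) ^ (3/4 : ℝ))) :=
        expNegInvGlue.contDiff.comp (contDiff_const.sub (contDiff_id.div_const _))
      have h := kinWitness_isDivFree_swirlField _ hφ ((1 - t) ^ (-(7/8 : ℝ)))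
      have hfun : F t = fun x : EuclideanSpace ℝ (Fin 3) =>
          ((1 - t) ^ (-(7/8 : ℝ)) * expNegInvGlue (4 - ‖x‖ ^ 2 / (1 - t) ^ (3/4 : ℝ))) •
            (WithLp.toLp 2 ![-(x 1), x 0, 0] : EuclideanSpace ℝ (Fin 3)) := by
        funext x
        simp only [hF, if_pos ht]
      rw [hfun]
      exact h
    · have hfun : F t = fun _ : EuclideanSpace ℝ (Fin 3) => (0 : EuclideanSpace ℝ (Fin 3)) := by
        funext x
        simp only [hF, if_neg ht]
      rw [hfun]
      intro x
      simp [VectorCalculus.divergence]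
  -- assembly, with `δ := min δ₁ (1/2)`
  have hδle : min δ₁ (1/2) ≤ δ₁ := min_le_left _ _
  have hδnn : 0 ≤ min δ₁ (1/2) := le_min hδ₁.le (by norm_num)
  refine ⟨min δ₁ (1/2), lt_min hδ₁ (by norm_num), lt_of_le_of_lt (min_le_right _ _) (by norm_num), F,
    hcd.mono (Set.prod_mono (fun _ ht => ht.2) Subset.rfl), hdiv, hE, fun t ht x => hTI t x ht, hcasc,
    ⟨r₂, hr₂, fun r hr => hmix r hr _ hδnn hδle⟩, fun r₀ hr₀ => ?_⟩
  refine ⟨min r₀ r₂ / 2, ⟨by positivity, by linarith [min_le_left r₀ r₂, lt_min hr₀ hr₂]⟩, ?_⟩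
  exact hmix _ ⟨by positivity, by linarith [min_le_right r₀ r₂, lt_min hr₀ hr₂]⟩ _ hδnn hδle

/-- **Stub B is false without the momentum equation** (registered sub-goal). The statement of the registered
stub `stub_coherentCascadeExclusion` with its Navier–Stokes class hypotheses (`IsClassicalNSSolutionOn (Ico 0 T)
1 0 u p`, `IsLerayHopfOn T 1 0 (u 0) u`, `HasRapidSpatialDecay (u 0)`) replaced by the KINEMATIC class — smooth
space–time field on `[0,T) × ℝ³`, divergence free, uniformly bounded finite energy, and even the `L∞` Type-I
bound `√(T−t)‖u‖ ≤ 2` — is false: the swirling core of `coherentCascade_kinematicWitness` (`T = 1`, `x₀ = 0`)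
satisfies both hypotheses of B. Hence incompressibility, the energy class, the Type-I rate and smoothness do not
exclude recurrent (indeed cofinal) coherent loaded scales at a blow-up point; a proof of B, or of the crux S2,
must use the Navier–Stokes dynamics. -/
theorem stub_coherentCascadeExclusion_false_without_momentum :
    ¬ (∀ δ : ℝ, 0 < δ → δ < 1 → ∀ T : ℝ, 0 < T →
      ∀ (u : ℝ → EuclideanSpace ℝ (Fin 3) → EuclideanSpace ℝ (Fin 3)),
      Literature.Analysis.FluidPDE.IsSmoothSpaceTimeOn (Set.Ico 0 T) u →
      (∀ t ∈ Set.Ico 0 T, Literature.Analysis.FluidPDE.VectorCalculus.IsDivFree (u t)) →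
      (∃ E₀ : ℝ, ∀ t ∈ Set.Ico 0 T, MeasureTheory.MemLp (u t) 2 MeasureTheory.volume ∧ ∫ x, ‖u t x‖ ^ 2 ≤ E₀) →
      (∀ t ∈ Set.Ico 0 T, ∀ x : EuclideanSpace ℝ (Fin 3), Real.sqrt (T - t) * ‖u t x‖ ≤ 2) →
      ∀ x₀ : EuclideanSpace ℝ (Fin 3),
      (∀ M' : ℝ, ∃ r₁ : ℝ, 0 < r₁ ∧ ∀ r ∈ Set.Ioo 0 r₁,
          ENNReal.ofReal M' ≤ Literature.Analysis.FluidPDE.cknC r ((T, x₀) : ℝ × EuclideanSpace ℝ (Fin 3)) u) →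
      (∀ r₀ : ℝ, 0 < r₀ → ∃ r ∈ Set.Ioo 0 r₀, ¬ Literature.Analysis.FluidPDE.DissipatesAtScale u T x₀ r δ) →
      False) := by
  intro h
  obtain ⟨δ, hδ, hδ1, u, hsm, hdiv, hE, hTI, hcasc, -, hrec⟩ := coherentCascade_kinematicWitness
  obtain ⟨E₀, hE₀⟩ := hE
  exact h δ hδ hδ1 1 one_pos u hsm (fun t _ => hdiv t) ⟨E₀, fun t ht => hE₀ t ht.1⟩
    (fun t ht x => hTI t ht.2 x) 0 hcasc hrec

end Summit.NavierStokesRegularity.NavierStokesRegularity.Theorems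

end
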